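import Literature.RepresentationTheory.HeisenbergGroup.SchrodingerPiOperators
import HarnessLib

/-!
# Fixed vectors of the Levi and unipotent operators of the Schrödinger model on `𝒮(F^ι)` (smoothness on `P`)

Topic `RepresentationTheory/HeisenbergGroup`; namespace `Literature.RepresentationTheory.HeisenbergGroup`. KERNEL
mathematics only (theorems; no definition, no named fact, no `axiom`, no `sorry`). Sequel of
`SchrodingerPiOperators.lean` (the operators `leviOpPi a` — `Φ ↦ |det a|^{-1/2} Φ ∘ a⁻¹` — and `unipOpPi c` —
multiplication by `ψ(-½⟨u, c u⟩)` — of the Schrödinger model of `Sp(F^ι ⊕ F^ι)` on `𝒮(F^ι)`).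

The representation of the Siegel parabolic `P = M N` on `𝒮(F^ι)` by these operators is SMOOTH: every
Schwartz–Bruhat function is fixed by `r(p)` for `p` in a neighbourhood of `1` in `P` ([MoeglinVignerasWaldspurger1987]
Chap. 2 II.6, II.8: "la représentation de `P(F)` sur `𝒮(X)` … est lisse"; [Weil1964] n° 11, n° 13). We state the
two fixed-vector lemmas with EXPLICIT boxes, so that any definition of a congruence neighbourhood can feed them:
for `Φ ∈ 𝒮(F^ι)` supported in the box `(𝔭^M)^ι` and `(𝔭^N)^ι`-periodic
(`Automorphic.exists_eq_zero_of_notMem_piPrimePowBall`, `Automorphic.exists_forall_add_eq_of_mem_schwartzBruhat_pi`),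
* `leviOpPi_eq_self_of_box`: `r(m(a)) Φ = Φ` as soon as `|det a| = 1`, `a⁻¹` preserves the box `(𝔭^M)^ι` and
  moves its points by at most `(𝔭^N)^ι` (`a⁻¹ u - u ∈ (𝔭^N)^ι` for `u ∈ (𝔭^M)^ι`);
* `unipOpPi_eq_self_of_box`: `r(n(c)) Φ = Φ` as soon as `½⟨u, c u⟩ ∈ 𝔭^m` on the box `(𝔭^M)^ι`, `𝔭^m` the
  conductor of `ψ`;
* `exists_box_levi_unip_eq_self`: the two together, with the boxes existentially bound, for every `Φ`.

## References

* C. Mœglin, M.-F. Vignéras, J.-L. Waldspurger, LNM 1291 (1987), Chap. 2 II.6, II.8 [MoeglinVignerasWaldspurger1987].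
* A. Weil, Acta Math. 111 (1964) 143–211: n° 11, n° 13 [Weil1964].
-/

set_option autoImplicit false

noncomputable section

namespace Literature.RepresentationTheory.HeisenbergGroup

open Literature.NumberTheory.Automorphic
open Literature.NumberTheory.GaloisRepresentations.IsNonarchimedeanLocalField

variable {F : Type*} [Field F] [ValuativeRel F] [TopologicalSpace F] [IsNonarchimedeanLocalField F]
  {ι : Type*} [Fintype ι] [Invertible (2 : F)]
  {ψ : AddChar F Circle} (hl : IsLocallyConstant (⇑ψ : F → Circle))

omit [Invertible (2 : F)] in
/-- **`r(m(a)) Φ = Φ` for `a` close to `1`** (explicit form): if `Φ` vanishes off the box `(𝔭^M)^ι` and is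
`(𝔭^N)^ι`-periodic, `|det a| = 1`, `a⁻¹` preserves `(𝔭^M)^ι` and `a⁻¹ u - u ∈ (𝔭^N)^ι` for `u ∈ (𝔭^M)^ι`, then
`leviOpPi a Φ = Φ`. [cite: MoeglinVignerasWaldspurger1987, Chap. 2 II.6 and II.8; Weil1964, n° 11, p. 157] -/
theorem leviOpPi_eq_self_of_box (a : (ι → F) ≃ₗ[F] (ι → F)) (Φ : SchwartzBruhat (ι → F)) {M N : ℤ}
    (hsupp : ∀ u ∉ piPrimePowBall F ι M, (Φ : (ι → F) → ℂ) u = 0)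
    (hper : ∀ x, ∀ t ∈ piPrimePowBall F ι N, (Φ : (ι → F) → ℂ) (x + t) = (Φ : (ι → F) → ℂ) x)
    (hdet : modSqrt a = 1) (hbox : ∀ u, a.symm u ∈ piPrimePowBall F ι M ↔ u ∈ piPrimePowBall F ι M)
    (hnear : ∀ u ∈ piPrimePowBall F ι M, a.symm u - u ∈ piPrimePowBall F ι N) : leviOpPi a Φ = Φ := by
  apply Subtype.ext
  funext u
  rw [coe_leviOpPi_apply, hdet, Complex.ofReal_one, inv_one, one_mul]
  by_cases hu : u ∈ piPrimePowBall F ι M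
  · have h := hper u (a.symm u - u) (hnear u hu)
    rwa [add_sub_cancel] at h
  · rw [hsupp u hu, hsupp _ (mt (hbox u).1 hu)]

omit [Invertible (2 : F)] in
/-- the same with the hypotheses on `a` instead of `a⁻¹` (`r(m(a⁻¹)) = r(m(a))⁻¹`).
[cite: MoeglinVignerasWaldspurger1987, Chap. 2 II.6 and II.8; Weil1964, n° 11, p. 157] -/
theorem leviOpPi_eq_self_of_box' (a : (ι → F) ≃ₗ[F] (ι → F)) (Φ : SchwartzBruhat (ι → F)) {M N : ℤ}
    (hsupp : ∀ u ∉ piPrimePowBall F ι M, (Φ : (ι → F) → ℂ) u = 0)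
    (hper : ∀ x, ∀ t ∈ piPrimePowBall F ι N, (Φ : (ι → F) → ℂ) (x + t) = (Φ : (ι → F) → ℂ) x)
    (hdet : modSqrt a = 1) (hbox : ∀ u, a u ∈ piPrimePowBall F ι M ↔ u ∈ piPrimePowBall F ι M)
    (hnear : ∀ u ∈ piPrimePowBall F ι M, a u - u ∈ piPrimePowBall F ι N) : leviOpPi a Φ = Φ := by
  have h := leviOpPi_eq_self_of_box a.symm Φ hsupp hper (by rw [modSqrt_symm, hdet, inv_one])
    (fun u => by rw [LinearEquiv.symm_symm]; exact hbox u) (fun u hu => by rw [LinearEquiv.symm_symm]; exact hnear u hu)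
  rw [leviOpPi_symm] at h
  have h' := congrArg (leviOpPi a) h
  rw [← LinearEquiv.mul_apply, mul_inv_cancel] at h'
  exact h'.symm

/-- **`r(n(c)) Φ = Φ` for `c` close to `0`** (explicit form): if `Φ` vanishes off the box `(𝔭^M)^ι` and
`½⟨u, c u⟩ ∈ 𝔭^m` for `u ∈ (𝔭^M)^ι`, where `𝔭^m` is the conductor of `ψ`, then `unipOpPi c Φ = Φ`.
[cite: MoeglinVignerasWaldspurger1987, Chap. 2 II.6 and II.8; Weil1964, n° 13, p. 160] -/
theorem unipOpPi_eq_self_of_box {m : ℤ} (hm : ψ.HasConductorExp m) (c : (ι → F) →ₗ[F] (ι → F))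
    (Φ : SchwartzBruhat (ι → F)) {M : ℤ} (hsupp : ∀ u ∉ piPrimePowBall F ι M, (Φ : (ι → F) → ℂ) u = 0)
    (hc : ∀ u ∈ piPrimePowBall F ι M, halfForm c u ∈ primePowBall F m) : unipOpPi hl c Φ = Φ := by
  apply Subtype.ext
  funext u
  rw [coe_unipOpPi_apply]
  by_cases hu : u ∈ piPrimePowBall F ι M
  · rw [hm.1 _ (neg_mem_primePowBall (hc u hu)), Circle.coe_one, one_mul]
  · rw [hsupp u hu, mul_zero]

/-- **both together, boxes existentially bound**: for every `Φ ∈ 𝒮(F^ι)` there are `M N : ℤ` such that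
`r(m(a)) Φ = Φ` for every `a` with `|det a| = 1`, `a⁻¹(𝔭^M)^ι = (𝔭^M)^ι` pointwise-close to `1` by `(𝔭^N)^ι` on
`(𝔭^M)^ι`, and `r(n(c)) Φ = Φ` for every `c` with `½⟨u, cu⟩ ∈ 𝔭^m` on `(𝔭^M)^ι` — the smoothness of `𝒮(F^ι)` under
the Siegel parabolic. [cite: MoeglinVignerasWaldspurger1987, Chap. 2 II.6 and II.8; Weil1964, n° 11, n° 13] -/
theorem exists_box_levi_unip_eq_self {m : ℤ} (hm : ψ.HasConductorExp m) (Φ : SchwartzBruhat (ι → F)) :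
    ∃ M N : ℤ,
      (∀ a : (ι → F) ≃ₗ[F] (ι → F), modSqrt a = 1 →
        (∀ u, a.symm u ∈ piPrimePowBall F ι M ↔ u ∈ piPrimePowBall F ι M) →
        (∀ u ∈ piPrimePowBall F ι M, a.symm u - u ∈ piPrimePowBall F ι N) → leviOpPi a Φ = Φ) ∧
      (∀ c : (ι → F) →ₗ[F] (ι → F), (∀ u ∈ piPrimePowBall F ι M, halfForm c u ∈ primePowBall F m) →
        unipOpPi hl c Φ = Φ) := by
  obtain ⟨M, hM⟩ := exists_eq_zero_of_notMem_piPrimePowBall Φ.2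
  obtain ⟨N, hN⟩ := exists_forall_add_eq_of_mem_schwartzBruhat_pi Φ.2
  exact ⟨M, N, fun a hdet hbox hnear => leviOpPi_eq_self_of_box a Φ hM hN hdet hbox hnear,
    fun c hc => unipOpPi_eq_self_of_box hl hm c Φ hM hc⟩

end Literature.RepresentationTheory.HeisenbergGroup
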